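import Summits.MatrixMultiplication.MatrixMultiplication.Theorems.FarEdgeDescentPermStarClasses
import Summits.MatrixMultiplication.MatrixMultiplication.Theorems.FarEdgeDescentSignTwistCommPow
import HarnessLib

/-!
# The four classes of `2 × 2` stars are restriction-incomparable at every Kronecker level

Route `FarEdgeDescent` (cell `decomp-mm`, lens 2 «structural dichotomy (special vs generic)»,
gen 32), Kernel VII — classification, all levels; support for the aside `SubLogRate`
(stmt-MatrixMultiplication-25371).

`FarEdgeDescentPermStarClasses` classifies the 24 stars `𝔖_φ = permStar K 2 1 φ` into four
classes (`cls`, sizes `4, 4, 8, 8`, representatives `⟨2,2,2⟩ ≅ 𝔖_{id}`, `𝔖^ᵀ`, `𝔖^♭`, `𝔖^♭ᵀ`)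
and shows that degeneration, restriction and isomorphism between two stars all coincide with
equality of classes.  Here the RESTRICTION statement is lifted to every Kronecker power
(`permStar_pow_restrictsTo_iff`, any field of characteristic `≠ 2`, every `N ≥ 1`):

  `𝔖_φ^{⊠N} ≥ 𝔖_ψ^{⊠N} ⇔ 𝔖_φ^{⊠N} ≅ 𝔖_ψ^{⊠N} ⇔ cls φ = cls ψ`.

Two inputs.  (1) PROBES (general `n, L ≥ 1`): every slice of `𝔖_φ`, in each slot, has an entry
equal to `1` at which all other slices of that slot vanish (`permStar_probe₁/₂/₃`); probes
multiply under Kronecker powers (`kroneckerPow_probe₁/₂/₃`), so by the inversion lemma of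
Kernel VI-c (`TensorRestrictsTo.symm_of_probes`, BCS §14.2) a restriction
`𝔖_φ^{⊠N} ≥ 𝔖_ψ^{⊠N}` between stars of the same format is invertible
(`permStar_pow_restrictsTo_symm`, general `n, L`).  (2) The five all-level non-degenerations
`⟨2,2,2⟩^{⊠N} ⋭ X^{⊠N}` (`X` generic), `𝔖^ᵀ^{⊠N} ⋭ 𝔖^♭^{⊠N}, 𝔖^♭ᵀ^{⊠N}`,
`𝔖^♭^{⊠N} ⋭ 𝔖^♭ᵀ^{⊠N}` (Kernels VI, VII) forbid one direction of every would-be isomorphism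
between distinct classes (`rep_pow_not_iso`).

What stays open at `N ≥ 2` is only the DEGENERATION order between distinct generic classes in
the six "downward" directions (e.g. `𝔖^♭^{⊠N} ⊵ 𝔖^ᵀ^{⊠N}`?), settled at `N = 1` by
`FarEdgeDescentGenericAntichain`.

References: P. Bürgisser, M. Clausen, M. A. Shokrollahi, *Algebraic Complexity Theory* (1997),
§14.2, (15.19) [BurgisserClausenShokrollahi1997]; H. Cohn, C. Umans, SODA 2013, §3
[CohnUmans2013]; M. Bläser, M. Christandl, J. Zuiddam, arXiv:1705.09652
[BlaserChristandlZuiddam2017].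
-/

noncomputable section

open scoped BigOperators

set_option linter.dupNamespace false

namespace Summit.MatrixMultiplication.MatrixMultiplication.Theorems.FarEdgeDescentPermStarClassesPow

open Literature.Computability.AlgebraicComplexity
open Summit.MatrixMultiplication.MatrixMultiplication.Theorems.FarEdgeDescentTwistedStar
open Summit.MatrixMultiplication.MatrixMultiplication.Theorems.FarEdgeDescentTwistRigidity
open Summit.MatrixMultiplication.MatrixMultiplication.Theorems.FarEdgeDescentSignTwist
open Summit.MatrixMultiplication.MatrixMultiplication.Theorems.FarEdgeDescentSignTwistDet
open Summit.MatrixMultiplication.MatrixMultiplication.Theorems.FarEdgeDescentSignTwistCommPow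
open Summit.MatrixMultiplication.MatrixMultiplication.Theorems.FarEdgeDescentPermStarClasses

universe u

/-! ## Probes multiply under Kronecker powers -/

section Lift
variable {K : Type u} [Field K] {ι κ μ : Type*}

/-- Slot-1 probes of `t^{⊠N}` from slot-1 probes of `t`. [folklore] -/
theorem kroneckerPow_probe₁ [DecidableEq ι] {t : ι → κ → μ → K}
    (h : ∀ a₀ : ι, ∃ b c, ∀ a, t a b c = if a = a₀ then 1 else 0) (N : ℕ) (a₀ : Fin N → ι) :
    ∃ b c, ∀ a, kroneckerPow t N a b c = if a = a₀ then 1 else 0 := by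
  choose fb fc hf using h
  refine ⟨fun i => fb (a₀ i), fun i => fc (a₀ i), fun a => ?_⟩
  rw [kroneckerPow_apply]
  simp only [hf, Finset.prod_boole, Finset.mem_univ, true_implies, funext_iff]

/-- Slot-2 probes of `t^{⊠N}` from slot-2 probes of `t`. [folklore] -/
theorem kroneckerPow_probe₂ [DecidableEq κ] {t : ι → κ → μ → K}
    (h : ∀ b₀ : κ, ∃ a c, ∀ b, t a b c = if b = b₀ then 1 else 0) (N : ℕ) (b₀ : Fin N → κ) :
    ∃ a c, ∀ b, kroneckerPow t N a b c = if b = b₀ then 1 else 0 := by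
  choose fa fc hf using h
  refine ⟨fun i => fa (b₀ i), fun i => fc (b₀ i), fun b => ?_⟩
  rw [kroneckerPow_apply]
  simp only [hf, Finset.prod_boole, Finset.mem_univ, true_implies, funext_iff]

/-- Slot-3 probes of `t^{⊠N}` from slot-3 probes of `t`. [folklore] -/
theorem kroneckerPow_probe₃ [DecidableEq μ] {t : ι → κ → μ → K}
    (h : ∀ c₀ : μ, ∃ a b, ∀ c, t a b c = if c = c₀ then 1 else 0) (N : ℕ) (c₀ : Fin N → μ) :
    ∃ a b, ∀ c, kroneckerPow t N a b c = if c = c₀ then 1 else 0 := by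
  choose fa fb hf using h
  refine ⟨fun i => fa (c₀ i), fun i => fb (c₀ i), fun c => ?_⟩
  rw [kroneckerPow_apply]
  simp only [hf, Finset.prod_boole, Finset.mem_univ, true_implies, funext_iff]

end Lift

/-! ## Probes of `𝔖_φ` (general `n, L ≥ 1`) and invertibility of restrictions between stars -/

section Probes
variable (K : Type u) [Field K] {n L : ℕ}

/-- Slot-1 probes of `𝔖_φ` (`n ≥ 1`): the leaf `inl (κ,ν)` is read at `b = (κ,0)`,
`c = inl (0,ν)`; the leaf `inr (κ,ν)` at `b = φ⁻¹(κ,0)`, `c = inr (0,ν)`. [folklore] -/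
theorem permStar_probe₁ (hn : 1 ≤ n) (φ : Equiv.Perm (Fin n × Fin n))
    (a₀ : (Fin n × Fin L) ⊕ (Fin n × Fin L)) :
    ∃ b c, ∀ a, permStar K n L φ a b c = if a = a₀ then 1 else 0 := by
  rcases a₀ with ⟨k, ν⟩ | ⟨k, ν⟩
  · refine ⟨(k, ⟨0, by omega⟩), Sum.inl (⟨0, by omega⟩, ν), fun a => ?_⟩
    rcases a with ⟨i, l⟩ | ⟨i, l⟩
    · simp [matMulTensor_def]
    · simp
  · refine ⟨φ⁻¹ (k, ⟨0, by omega⟩), Sum.inr (⟨0, by omega⟩, ν), fun a => ?_⟩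
    rcases a with ⟨i, l⟩ | ⟨i, l⟩
    · simp
    · simp [matMulTensor_def]

/-- Slot-2 probes of `𝔖_φ` (`L ≥ 1`): the entry `b₀` is read in the `inl` block at
`a = inl (b₀.1, 0)`, `c = inl (b₀.2, 0)`. [folklore] -/
theorem permStar_probe₂ (hL : 1 ≤ L) (φ : Equiv.Perm (Fin n × Fin n)) (b₀ : Fin n × Fin n) :
    ∃ a c, ∀ b, permStar K n L φ a b c = if b = b₀ then 1 else 0 := by
  refine ⟨Sum.inl (b₀.1, ⟨0, by omega⟩), Sum.inl (b₀.2, ⟨0, by omega⟩), fun b => ?_⟩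
  have e : (b₀.1 = b.1 ∧ b.2 = b₀.2) ↔ b = b₀ :=
    ⟨fun h => Prod.ext h.1.symm h.2, fun h => ⟨by rw [h], by rw [h]⟩⟩
  simp only [permStar_inl_inl, matMulTensor_def, and_true, e]

/-- Slot-3 probes of `𝔖_φ` (`n ≥ 1`): the leaf `inl (m,ν)` is read at `a = inl (0,ν)`,
`b = (0,m)`; the leaf `inr (m,ν)` at `a = inr (0,ν)`, `b = φ⁻¹(0,m)`. [folklore] -/
theorem permStar_probe₃ (hn : 1 ≤ n) (φ : Equiv.Perm (Fin n × Fin n))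
    (c₀ : (Fin n × Fin L) ⊕ (Fin n × Fin L)) :
    ∃ a b, ∀ c, permStar K n L φ a b c = if c = c₀ then 1 else 0 := by
  rcases c₀ with ⟨m, ν⟩ | ⟨m, ν⟩
  · refine ⟨Sum.inl (⟨0, by omega⟩, ν), (⟨0, by omega⟩, m), fun c => ?_⟩
    rcases c with ⟨j, l⟩ | ⟨j, l⟩
    · have e : (m = j ∧ ν = l) ↔ (j = m ∧ l = ν) :=
        ⟨fun h => ⟨h.1.symm, h.2.symm⟩, fun h => ⟨h.1.symm, h.2.symm⟩⟩
      simp [matMulTensor_def, e]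
    · simp
  · refine ⟨Sum.inr (⟨0, by omega⟩, ν), φ⁻¹ (⟨0, by omega⟩, m), fun c => ?_⟩
    rcases c with ⟨j, l⟩ | ⟨j, l⟩
    · simp
    · have e : (m = j ∧ ν = l) ↔ (j = m ∧ l = ν) :=
        ⟨fun h => ⟨h.1.symm, h.2.symm⟩, fun h => ⟨h.1.symm, h.2.symm⟩⟩
      simp [matMulTensor_def, e]

/-- **Restrictions between stars of the same format are invertible at every level**
(`n, L ≥ 1`): `𝔖_φ^{⊠N} ≥ 𝔖_ψ^{⊠N} ⇒ 𝔖_ψ^{⊠N} ≥ 𝔖_φ^{⊠N}` (inversion lemma + probes).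
[cite: BurgisserClausenShokrollahi1997, §14.2] -/
theorem permStar_pow_restrictsTo_symm (hn : 1 ≤ n) (hL : 1 ≤ L)
    {φ ψ : Equiv.Perm (Fin n × Fin n)} {N : ℕ}
    (h : TensorRestrictsTo (kroneckerPow (permStar K n L φ) N)
      (kroneckerPow (permStar K n L ψ) N)) :
    TensorRestrictsTo (kroneckerPow (permStar K n L ψ) N) (kroneckerPow (permStar K n L φ) N) := by
  classical
  exact TensorRestrictsTo.symm_of_probes (Equiv.refl _) (Equiv.refl _) (Equiv.refl _)
    (kroneckerPow_probe₁ (permStar_probe₁ K hn ψ) N)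
    (kroneckerPow_probe₂ (permStar_probe₂ K hL ψ) N)
    (kroneckerPow_probe₃ (permStar_probe₃ K hn ψ) N) h

/-- Hence restriction between powers of stars of the same format is isomorphism.
[cite: BurgisserClausenShokrollahi1997, §14.2] -/
theorem permStar_pow_iso_of_restrictsTo (hn : 1 ≤ n) (hL : 1 ≤ L)
    {φ ψ : Equiv.Perm (Fin n × Fin n)} {N : ℕ}
    (h : TensorRestrictsTo (kroneckerPow (permStar K n L φ) N)
      (kroneckerPow (permStar K n L ψ) N)) :
    TensorIso (kroneckerPow (permStar K n L φ) N) (kroneckerPow (permStar K n L ψ) N) :=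
  ⟨h, permStar_pow_restrictsTo_symm K hn hL h⟩

end Probes

/-! ## `n = 2`, `L = 1`: the four classes at every level -/

section Classes
variable (K : Type u) [Field K]

/-- Kronecker powers of mutual restrictions. [folklore] -/
theorem TensorIso.kroneckerPow {ι κ μ ι' κ' μ' : Type*} [Fintype ι] [Fintype κ] [Fintype μ]
    [Fintype ι'] [Fintype κ'] [Fintype μ'] {s : ι → κ → μ → K} {t : ι' → κ' → μ' → K}
    (h : TensorIso s t) (N : ℕ) : TensorIso (kroneckerPow s N) (kroneckerPow t N) :=
  ⟨h.1.kroneckerPow N, h.2.kroneckerPow N⟩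

/-- **No two of `⟨2,2,2⟩^{⊠N}, 𝔖^ᵀ^{⊠N}, 𝔖^♭^{⊠N}, 𝔖^♭ᵀ^{⊠N}` are isomorphic** (`N ≥ 1`,
characteristic `≠ 2`): one direction of each would-be isomorphism is an all-level
non-degeneration of Kernels VI–VII. [cite: BurgisserClausenShokrollahi1997, (15.19), sec. 20.2] -/
theorem rep_pow_not_iso (h2 : (2 : K) ≠ 0) (N : ℕ) (hN : 1 ≤ N) :
    ∀ i j : Fin 4, i ≠ j → ¬ TensorIso (kroneckerPow (rep K i) N) (kroneckerPow (rep K j) N) := by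
  have m0 : TensorRestrictsTo (kroneckerPow (matMulTensor K 2 2 (1 + 1)) N)
      (kroneckerPow (permStar K 2 1 (Equiv.refl _)) N) :=
    (matMul_restrictsTo_permStar IsProdPerm.refl).kroneckerPow N
  have r0 : TensorRestrictsTo (kroneckerPow (permStar K 2 1 (Equiv.refl _)) N)
      (kroneckerPow (matMulTensor K 2 2 (1 + 1)) N) :=
    (permStar_restrictsTo_matMul IsProdPerm.refl).kroneckerPow N
  have hT := permStar_pow_restriction_incomparable (K := K) (L := 1) (N := N)
    (not_isProdPerm_prodComm (n := 2) le_rfl) le_rfl hN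
  rw [permStar_prodComm] at hT
  have hF := matMul_pow_incomparable_signStar_pow K h2 N hN
  have hG := matMul_pow_incomparable_signTStar_pow K h2 N hN
  have hTF := twistedStar_pow_not_algDegeneratesTo_signStar (K := K) N hN
  have hTG := twistedStar_pow_not_algDegeneratesTo_signTStar (K := K) h2 N hN
  have hFG := signStar_pow_not_algDegeneratesTo_signTStar_pow (K := K) N hN
  intro i j hij
  fin_cases i <;> fin_cases j
  · exact absurd rfl hij
  · exact fun e => hT.2 (m0.trans e.1)
  · exact fun e => hF.1 (m0.trans e.1)
  · exact fun e => hG.1 (m0.trans e.1)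
  · exact fun e => hT.1 (e.1.trans r0)
  · exact absurd rfl hij
  · exact fun e => hTF e.1.algDegeneratesTo
  · exact fun e => hTG e.1.algDegeneratesTo
  · exact fun e => hF.2 (e.1.trans r0)
  · exact fun e => hTF e.2.algDegeneratesTo
  · exact absurd rfl hij
  · exact fun e => hFG e.1.algDegeneratesTo
  · exact fun e => hG.2 (e.1.trans r0)
  · exact fun e => hTG e.2.algDegeneratesTo
  · exact fun e => hFG e.2.algDegeneratesTo
  · exact absurd rfl hij

/-- **CLASSIFICATION BY RESTRICTION AT EVERY LEVEL** (`n = 2`, `L = 1`, characteristic `≠ 2`,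
`N ≥ 1`): `𝔖_φ^{⊠N} ≥ 𝔖_ψ^{⊠N}` iff `cls φ = cls ψ`.  The restriction order on the `N`-th powers
of the 24 stars is equality of the four classes.
[cite: BurgisserClausenShokrollahi1997, §14.2, (15.19)] -/
theorem permStar_pow_restrictsTo_iff (h2 : (2 : K) ≠ 0) (N : ℕ) (hN : 1 ≤ N)
    (φ ψ : Equiv.Perm (Fin 2 × Fin 2)) :
    TensorRestrictsTo (kroneckerPow (permStar K 2 1 φ) N) (kroneckerPow (permStar K 2 1 ψ) N) ↔
      cls φ = cls ψ := by
  constructor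
  · intro h
    by_contra hne
    have e := permStar_pow_iso_of_restrictsTo K (n := 2) (L := 1) (by norm_num) le_rfl h
    exact rep_pow_not_iso K h2 N hN _ _ hne
      (((TensorIso.kroneckerPow K (permStar_iso_rep K h2 φ) N).symm.trans e).trans
        (TensorIso.kroneckerPow K (permStar_iso_rep K h2 ψ) N))
  · intro h
    have e := permStar_iso_rep K h2 φ
    rw [h] at e
    exact (TensorIso.kroneckerPow K (e.trans (permStar_iso_rep K h2 ψ).symm) N).1

/-- **Isomorphism version**: `𝔖_φ^{⊠N} ≅ 𝔖_ψ^{⊠N}` iff `cls φ = cls ψ` (`N ≥ 1`).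
[cite: BurgisserClausenShokrollahi1997, §14.2] -/
theorem permStar_pow_iso_iff (h2 : (2 : K) ≠ 0) (N : ℕ) (hN : 1 ≤ N)
    (φ ψ : Equiv.Perm (Fin 2 × Fin 2)) :
    TensorIso (kroneckerPow (permStar K 2 1 φ) N) (kroneckerPow (permStar K 2 1 ψ) N) ↔
      cls φ = cls ψ :=
  ⟨fun e => (permStar_pow_restrictsTo_iff K h2 N hN φ ψ).mp e.1,
    fun h => ⟨(permStar_pow_restrictsTo_iff K h2 N hN φ ψ).mpr h,
      (permStar_pow_restrictsTo_iff K h2 N hN ψ φ).mpr h.symm⟩⟩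

/-- **Special vs generic at every level, restriction form**: `𝔖_φ^{⊠N} ≥ ⟨2,2,2⟩^{⊠N}` iff
`⟨2,2,2⟩^{⊠N} ≥ 𝔖_φ^{⊠N}` iff `φ` is a product relabeling; and two GENERIC stars have
comparable `N`-th powers iff they lie in the same one of the three generic classes.
[cite: BurgisserClausenShokrollahi1997, §14.2, (15.19)] -/
theorem special_generic_pow (h2 : (2 : K) ≠ 0) (N : ℕ) (hN : 1 ≤ N)
    (φ ψ : Equiv.Perm (Fin 2 × Fin 2)) :
    (TensorRestrictsTo (kroneckerPow (permStar K 2 1 φ) N)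
        (kroneckerPow (matMulTensor K 2 2 (1 + 1)) N) ↔ IsProdPerm φ) ∧
    (TensorRestrictsTo (kroneckerPow (matMulTensor K 2 2 (1 + 1)) N)
        (kroneckerPow (permStar K 2 1 φ) N) ↔ IsProdPerm φ) ∧
    (TensorRestrictsTo (kroneckerPow (permStar K 2 1 φ) N) (kroneckerPow (permStar K 2 1 ψ) N) ↔
      TensorRestrictsTo (kroneckerPow (permStar K 2 1 ψ) N) (kroneckerPow (permStar K 2 1 φ) N)) :=
  ⟨permStar_pow_restrictsTo_matMul_pow_iff φ le_rfl hN,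
    matMul_pow_restrictsTo_permStar_pow_iff φ le_rfl hN, by
      rw [permStar_pow_restrictsTo_iff K h2 N hN, permStar_pow_restrictsTo_iff K h2 N hN, eq_comm]⟩

end Classes

end Summit.MatrixMultiplication.MatrixMultiplication.Theorems.FarEdgeDescentPermStarClassesPow

end
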